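import Summits.QuantumFields.BalabanUV.Beta.WilsonStencilZ4

/-!
# `Beta.RemainderLogFree` — END of LEAF 2: the remainder vertex of the Wilson action contributes NOTHING to the logarithmic
# (one-loop) coefficient — its bubbles are `IsO 7`, so their second-moment partial sums are bounded UNIFORMLY IN THE CUTOFF

HONEST FRAMING (cell `pub-balaban`, β sub-cell, analysis prover AN3, generation 16; part 3 of 3 of LEAF 2 «REMAINDER-LOG-FREE»;
tree target `Summits/QuantumFields/BalabanUV/Beta/`).  Discharging `BetaPertH` would make Bałaban's ultraviolet stability
UNCONDITIONAL — a real constructive-QFT result; it is NOT the continuum limit and NOT the Clay problem.  This file discharges ONE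
LOCATED SUB-ITEM of the cell's β-function table, the item left open in the header of `Beta.PlaquetteStencil` («NOT PROVED HERE: any
estimate or table value of the remainder vertex `remVertex₁`»), in the following precise and modest sense: with the Wilson vertex
transcribed as the graded `ℤ⁴` stencil `wilsonStn = mainStn ++ remStn` (`Graded 1` / `Graded 2`, part 2, realised letter for letter
to `PlaquetteStencil.wilsonVertex₁` on every finite torus), the one-loop bubble `bub f₁ f₂ wilsonStn wilsonStn` differs from the
MAIN bubble `bub f₁ f₂ mainStn mainStn` (vector + longitudinal vertex: the tables of `SpinTable` / `GhostTable` / an2's consumers) by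
three cross/remainder bubbles of total grading `≥ 3`, hence (`GradedBubbles.isO_seven`, LEAF 1) of uniform decay degree `7` through
any legs with the difference budget `DG 3 2` — and an `IsO 7` table has second-moment partial sums `Σ_{0<‖z‖∞≤M} |z_μ z_ν F(z)|`
bounded by ONE constant for all `M` (`GradedBubbles.sum_abs_moment_le`): NO `log M`, so nothing of the remainder reaches a
coefficient read off the logarithmic slope of second moments.  UNCONDITIONAL for the free legs (`dg_three_free`); for a sharp
two-power family (Bałaban's effective propagators once (F1)–(F3) are supplied — rows an5/an1, NOT provided here) via `dg_three`.
Value = β-function BOOKKEEPING made rigorous; NOT summit progress.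

ABSOLUTE RULE.  No internally-minted statement may enter as a cited fact.  Every hypothesis is either kernel-proved in this package
or a verbatim quotation of a PUBLISHED theorem with page reference.  The manuscript(s) under audit are NOT citable for their own
disputed steps — they are the thing under adjudication; programme-internal (2001/route/tribunal) claims are never citable.  In this
file NOTHING is cited: every statement is proved from parts 1–2 and the UNMODIFIED Literature leaves `GradedBubbles`,
`PlaquetteStencil`, `BubbleTable` (imported BY NAME).

WHAT IS PROVED ([folklore] throughout; `I = C × Fin 4`).
* §1 `bub_wilson_sub_main`: `bub f₁ f₂ W W′ − bub f₁ f₂ M M′ = bub M R′ + bub R M′ + bub R R′` (bilinearity of LEAF 1's `bub`);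
  `isO_seven_wilson_sub_main`: `DG 3 2 f₁ → DG 3 2 f₂ → IsO 7 (bub f₁ f₂ (wilsonStn γ A) (wilsonStn γ′ A′) − bub f₁ f₂ (mainStn γ A)
  (mainStn γ′ A′))`, with the three pieces separately (`isO_seven_main_rem`, `isO_seven_rem_main`, `isO_seven_rem_rem`), the sharp
  two-power and the FREE specialisations.
* §2 COUNTING: `sum_abs_moment_wilson_sub_main_le` — one constant bounds `Σ_{z ∈ annulus 4 0 M} |z_μ z_ν (bub W W′ − bub M M′)(z)|` for
  all `L, k, M, μ, ν`; free anchor `…_free_le` unconditional.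
* §3 TORUS FORM: on every finite torus `Λ` with frame `e`, the bubble trace of two Wilson vertices (resp. main vertices) through
  colour-diagonal translation-invariant propagators IS the corresponding `ℤ⁴` table with periodised legs (part 1's link + part 2's
  dictionary): `trace_wilson_bubble`, `trace_main_bubble`, `trace_wilson_bubble_sub_main`.

NOT PROVED HERE, NOT CLAIMED.  (i) The passage from the periodised legs of a finite torus (§3, exact) to infinite-volume legs with
the budget `DG 3 2` (§§1–2) is the volume limit of the propagators — rows an5/an2, not treated.  (ii) (F1)–(F3) for Bałaban's
propagators.  (iii) The VALUE of the main bubble's logarithmic coefficient (the `11N/3` bookkeeping) — other leaves.  (iv) Anything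
about `BetaPertH` itself, the continuum limit, or the Clay problem.
-/

namespace Summit.QuantumFields.BalabanUV.Beta.RemainderLogFree

open Finset
open scoped BigOperators
open Literature.Probability.LatticeModels (annulus)
open Literature.MathematicalPhysics.QuantumFieldTheory.Balaban1983to89.Beta
open Literature.MathematicalPhysics.QuantumFieldTheory.Balaban1983to89.Beta.DyadicShell (Pt)
open Literature.MathematicalPhysics.QuantumFieldTheory.Balaban1983to89.Beta.TwoPowerLegs (TwoPower SharpDiff free)
open Literature.MathematicalPhysics.QuantumFieldTheory.Balaban1983to89.Beta.BubbleTable (convKernel)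
open Literature.MathematicalPhysics.QuantumFieldTheory.Balaban1983to89.Beta.SpinTable (vecVertex)
open Literature.MathematicalPhysics.QuantumFieldTheory.Balaban1983to89.Beta.PlaquetteWeitzenbock (sTot)
open Literature.MathematicalPhysics.QuantumFieldTheory.Balaban1983to89.Beta.PlaquetteStencil (divVertex remVertex₁ wilsonVertex₁)
open Literature.MathematicalPhysics.QuantumFieldTheory.Balaban1983to89.Beta.GradedBubbles
open Summit.QuantumFields.BalabanUV.Beta.GradedStencilDictionary
open Summit.QuantumFields.BalabanUV.Beta.WilsonStencilZ4

/-! ## §1 The remainder's bubbles are `IsO 7` -/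

section Decay

variable {C : Type*} [Fintype C]

/-- bilinear expansion: Wilson ⊗ Wilson minus main ⊗ main = the three bubbles containing a remainder vertex. [folklore] -/
theorem bub_wilson_sub_main (f₁ f₂ : Fam) (γ γ' : Fin 4) (A A' : Matrix C C ℝ) :
    bub f₁ f₂ (wilsonStn γ A) (wilsonStn γ' A') - bub f₁ f₂ (mainStn γ A) (mainStn γ' A') =
      bub f₁ f₂ (mainStn γ A) (remStn γ' A') + bub f₁ f₂ (remStn γ A) (mainStn γ' A') + bub f₁ f₂ (remStn γ A) (remStn γ' A') := by
  rw [wilsonStn, wilsonStn, bub_append_left, bub_append_right, bub_append_right]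
  abel

/-- main ⊗ remainder is `IsO 7` (grading `1 + 2`). [folklore] -/
theorem isO_seven_main_rem {f₁ f₂ : Fam} (h₁ : DG 3 2 f₁) (h₂ : DG 3 2 f₂) (γ γ' : Fin 4) (A A' : Matrix C C ℝ) :
    IsO 7 (bub f₁ f₂ (mainStn γ A) (remStn γ' A')) :=
  isO_seven (graded_mainStn γ A) (graded_remStn γ' A') (by norm_num) h₁ h₂

/-- remainder ⊗ main is `IsO 7` (grading `2 + 1`). [folklore] -/
theorem isO_seven_rem_main {f₁ f₂ : Fam} (h₁ : DG 3 2 f₁) (h₂ : DG 3 2 f₂) (γ γ' : Fin 4) (A A' : Matrix C C ℝ) :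
    IsO 7 (bub f₁ f₂ (remStn γ A) (mainStn γ' A')) :=
  isO_seven (graded_remStn γ A) (graded_mainStn γ' A') (by norm_num) h₁ h₂

/-- remainder ⊗ remainder is `IsO 7` (grading `2 + 2 ≥ 3`). [folklore] -/
theorem isO_seven_rem_rem {f₁ f₂ : Fam} (h₁ : DG 3 2 f₁) (h₂ : DG 3 2 f₂) (γ γ' : Fin 4) (A A' : Matrix C C ℝ) :
    IsO 7 (bub f₁ f₂ (remStn γ A) (remStn γ' A')) :=
  isO_seven (graded_remStn γ A) (graded_remStn γ' A') (by norm_num) h₁ h₂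

/-- remainder ⊗ ANY graded stencil is `IsO 7` as soon as the other vertex carries one difference. [folklore] -/
theorem isO_seven_rem_left {f₁ f₂ : Fam} (h₁ : DG 3 2 f₁) (h₂ : DG 3 2 f₂) (γ : Fin 4) (A : Matrix C C ℝ) {n : ℕ}
    {W : Stn (C × Fin 4)} (hW : Graded n W) (hn : 1 ≤ n) : IsO 7 (bub f₁ f₂ (remStn γ A) W) :=
  isO_seven (graded_remStn γ A) hW (by omega) h₁ h₂

/-- **THE LOG-FREE REMAINDER (abstract legs)**: through any legs with the difference budget `DG 3 2`, the Wilson bubble differs from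
the main bubble by an `IsO 7` table. [folklore] -/
theorem isO_seven_wilson_sub_main {f₁ f₂ : Fam} (h₁ : DG 3 2 f₁) (h₂ : DG 3 2 f₂) (γ γ' : Fin 4) (A A' : Matrix C C ℝ) :
    IsO 7 (bub f₁ f₂ (wilsonStn γ A) (wilsonStn γ' A') - bub f₁ f₂ (mainStn γ A) (mainStn γ' A')) := by
  rw [bub_wilson_sub_main]
  exact ((isO_seven_main_rem h₁ h₂ γ γ' A A').add (isO_seven_rem_main h₁ h₂ γ γ' A A')).add
    (isO_seven_rem_rem h₁ h₂ γ γ' A A')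

/-- the same, packaged as «Wilson bubble = main bubble + an `IsO 7` table». [folklore] -/
theorem bub_wilson_eq_main_add {f₁ f₂ : Fam} (h₁ : DG 3 2 f₁) (h₂ : DG 3 2 f₂) (γ γ' : Fin 4) (A A' : Matrix C C ℝ) :
    ∃ R : Fam, IsO 7 R ∧ bub f₁ f₂ (wilsonStn γ A) (wilsonStn γ' A') = bub f₁ f₂ (mainStn γ A) (mainStn γ' A') + R :=
  ⟨_, isO_seven_wilson_sub_main h₁ h₂ γ γ' A A', by abel⟩

/-- **through a SHARP TWO-POWER FAMILY** (both legs `T.g`; (F1)(F2) are fields of `T`, (F3) = `SharpDiff T B₃` a hypothesis — for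
Bałaban's propagators these are rows an5/an1 of the cell, NOT provided here). [folklore] -/
theorem isO_seven_wilson_sub_main_twoPower (T : TwoPower) {B₃ : ℝ} (hB : 0 ≤ B₃) (hT : SharpDiff T B₃) (γ γ' : Fin 4)
    (A A' : Matrix C C ℝ) :
    IsO 7 (bub T.g T.g (wilsonStn γ A) (wilsonStn γ' A') - bub T.g T.g (mainStn γ A) (mainStn γ' A')) :=
  isO_seven_wilson_sub_main (dg_three T hB hT) (dg_three T hB hT) γ γ' A A'

/-- **THE FREE ANCHOR, UNCONDITIONALLY** (legs `latticeGreen/2`). [folklore] -/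
theorem isO_seven_wilson_sub_main_free (γ γ' : Fin 4) (A A' : Matrix C C ℝ) :
    IsO 7 (bub free.g free.g (wilsonStn γ A) (wilsonStn γ' A') - bub free.g free.g (mainStn γ A) (mainStn γ' A')) :=
  isO_seven_wilson_sub_main dg_three_free dg_three_free γ γ' A A'

end Decay

/-! ## §2 Counting: no logarithm from the remainder -/

section Counting

variable {C : Type*} [Fintype C]

/-- **NO LOGARITHM FROM THE REMAINDER VERTEX**: the second-moment partial sums of (Wilson bubble − main bubble) are bounded by ONE
constant for all cutoffs `M`, all `μ ν`, all `(L,k)` — whereas a degree-6 table's second moments grow like `log M` and carry the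
one-loop coefficient (`TransferUV`).  Hence the logarithmic coefficient of the Wilson bubble IS that of the main (vector + longitudinal)
bubble. [folklore] -/
theorem sum_abs_moment_wilson_sub_main_le {f₁ f₂ : Fam} (h₁ : DG 3 2 f₁) (h₂ : DG 3 2 f₂) (γ γ' : Fin 4) (A A' : Matrix C C ℝ) :
    ∃ B : ℝ, 0 ≤ B ∧ ∀ (L k M : ℕ) (μ ν : Fin 4),
      ∑ z ∈ annulus 4 0 M, |((z μ : ℤ) : ℝ) * ((z ν : ℤ) : ℝ) *
        (bub f₁ f₂ (wilsonStn γ A) (wilsonStn γ' A') - bub f₁ f₂ (mainStn γ A) (mainStn γ' A')) L k z| ≤ B :=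
  sum_abs_moment_le (isO_seven_wilson_sub_main h₁ h₂ γ γ' A A')

/-- the same through a sharp two-power family. [folklore] -/
theorem sum_abs_moment_wilson_sub_main_twoPower_le (T : TwoPower) {B₃ : ℝ} (hB : 0 ≤ B₃) (hT : SharpDiff T B₃) (γ γ' : Fin 4)
    (A A' : Matrix C C ℝ) :
    ∃ B : ℝ, 0 ≤ B ∧ ∀ (L k M : ℕ) (μ ν : Fin 4),
      ∑ z ∈ annulus 4 0 M, |((z μ : ℤ) : ℝ) * ((z ν : ℤ) : ℝ) *
        (bub T.g T.g (wilsonStn γ A) (wilsonStn γ' A') - bub T.g T.g (mainStn γ A) (mainStn γ' A')) L k z| ≤ B :=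
  sum_abs_moment_le (isO_seven_wilson_sub_main_twoPower T hB hT γ γ' A A')

/-- **HEADLINE (free anchor, unconditional)**: through the free legs the remainder vertex of the Wilson action contributes no
logarithm to the one-loop bubble's second moments. [folklore] -/
theorem sum_abs_moment_wilson_sub_main_free_le (γ γ' : Fin 4) (A A' : Matrix C C ℝ) :
    ∃ B : ℝ, 0 ≤ B ∧ ∀ (L k M : ℕ) (μ ν : Fin 4),
      ∑ z ∈ annulus 4 0 M, |((z μ : ℤ) : ℝ) * ((z ν : ℤ) : ℝ) *
        (bub free.g free.g (wilsonStn γ A) (wilsonStn γ' A') - bub free.g free.g (mainStn γ A) (mainStn γ' A')) L k z| ≤ B :=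
  sum_abs_moment_le (isO_seven_wilson_sub_main_free γ γ' A A')

/-- and the remainder ⊗ remainder bubble alone (free legs). [folklore] -/
theorem sum_abs_moment_rem_rem_free_le (γ γ' : Fin 4) (A A' : Matrix C C ℝ) :
    ∃ B : ℝ, 0 ≤ B ∧ ∀ (L k M : ℕ) (μ ν : Fin 4),
      ∑ z ∈ annulus 4 0 M, |((z μ : ℤ) : ℝ) * ((z ν : ℤ) : ℝ) * bub free.g free.g (remStn γ A) (remStn γ' A') L k z| ≤ B :=
  sum_abs_moment_bub_free_le (graded_remStn γ A) (graded_remStn γ' A') (by norm_num)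

end Counting

/-! ## §3 Torus form: the finite-lattice bubble traces of `PlaquetteStencil.wilsonVertex₁` ARE these tables with periodised legs -/

section Torus

variable {C : Type*} [Fintype C] [DecidableEq C] {Λ : Type*} [Fintype Λ] [DecidableEq Λ] [AddCommGroup Λ] (e : Fin 4 → Λ)

/-- **WILSON ⊗ WILSON ON THE TORUS**: for colour-diagonal translation-invariant propagators `convKernel g`, `convKernel g′` on any finite
abelian `Λ` with frame `e`, the bubble trace of the Wilson vertices at the bonds `(z,γ)` and `(z + lift e w, γ′)` is the `ℤ⁴` table
`bub` of the Wilson stencils with the periodised legs, at `w`. [folklore] -/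
theorem trace_wilson_bubble (g g' : Λ → ℝ) (z : Λ) (w : Pt) (γ γ' : Fin 4) (A A' : Matrix C C ℝ) (L k : ℕ) :
    Matrix.trace (convKernel g * wilsonVertex₁ e z γ A * (convKernel g' * wilsonVertex₁ e (z + lift e w) γ' A')) =
      bub (perLeg e g) (perLeg e g') (wilsonStn γ A) (wilsonStn γ' A') L k w := by
  rw [← real_wilsonStn, ← real_wilsonStn, trace_real_bubble]

/-- MAIN ⊗ MAIN ON THE TORUS (main vertex `vecVertex sTot + 2•divVertex`). [folklore] -/
theorem trace_main_bubble (g g' : Λ → ℝ) (z : Λ) (w : Pt) (γ γ' : Fin 4) (A A' : Matrix C C ℝ) (L k : ℕ) :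
    Matrix.trace (convKernel g * (vecVertex sTot e z γ A + (2 : ℝ) • divVertex e z γ A) *
        (convKernel g' * (vecVertex sTot e (z + lift e w) γ' A' + (2 : ℝ) • divVertex e (z + lift e w) γ' A'))) =
      bub (perLeg e g) (perLeg e g') (mainStn γ A) (mainStn γ' A') L k w := by
  rw [← real_mainStn, ← real_mainStn, trace_real_bubble]

/-- REMAINDER ⊗ REMAINDER ON THE TORUS. [folklore] -/
theorem trace_rem_bubble (g g' : Λ → ℝ) (z : Λ) (w : Pt) (γ γ' : Fin 4) (A A' : Matrix C C ℝ) (L k : ℕ) :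
    Matrix.trace (convKernel g * remVertex₁ e z γ A * (convKernel g' * remVertex₁ e (z + lift e w) γ' A')) =
      bub (perLeg e g) (perLeg e g') (remStn γ A) (remStn γ' A') L k w := by
  rw [← real_remStn, ← real_remStn, trace_real_bubble]

/-- **THE DIFFERENCE ON THE TORUS**: (Wilson ⊗ Wilson) − (main ⊗ main) bubble traces = the `ℤ⁴` table of §1 with periodised legs —
the table which, for legs with the budget `DG 3 2`, is `IsO 7` (`isO_seven_wilson_sub_main`).  (The periodised legs of a fixed finite
torus do not themselves decay; the decay statement concerns their infinite-volume counterparts — item (i) of the header.) [folklore] -/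
theorem trace_wilson_bubble_sub_main (g g' : Λ → ℝ) (z : Λ) (w : Pt) (γ γ' : Fin 4) (A A' : Matrix C C ℝ) (L k : ℕ) :
    Matrix.trace (convKernel g * wilsonVertex₁ e z γ A * (convKernel g' * wilsonVertex₁ e (z + lift e w) γ' A')) -
        Matrix.trace (convKernel g * (vecVertex sTot e z γ A + (2 : ℝ) • divVertex e z γ A) *
          (convKernel g' * (vecVertex sTot e (z + lift e w) γ' A' + (2 : ℝ) • divVertex e (z + lift e w) γ' A'))) =
      (bub (perLeg e g) (perLeg e g') (wilsonStn γ A) (wilsonStn γ' A') -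
        bub (perLeg e g) (perLeg e g') (mainStn γ A) (mainStn γ' A')) L k w := by
  rw [trace_wilson_bubble, trace_main_bubble, Pi.sub_apply, Pi.sub_apply, Pi.sub_apply]

end Torus

end Summit.QuantumFields.BalabanUV.Beta.RemainderLogFree
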